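import Literature.NumberTheory.CubicFields.ThreeTorsionMeanBound
import Literature.NumberTheory.CubicFields.UniformityPerDiscBound
import HarnessLib

/-!
# BTT Prop. 4.5 (`btt_uniformity_sqDvd`) from Hasse's dictionary and Scholz's reflection theorem

`Proofs` file (theorems only), topic `Literature/NumberTheory/CubicFields`: the named fact
`btt_uniformity_sqDvd` (Bhargava–Taniguchi–Thorne 2023, Prop. 4.5: for squarefree `q`,
`Σ_{0<±D<X, q²∣D} h(D) = O(6^{ω(q)} X/q²)`) follows from the two class-field-theoretic named facts of the
tree

* `threeTorsion_eq_two_mul_cubicFieldCountOfDisc_add_one` (Hasse 1930: `#Cl₃(D) = 2·#{cubic fields of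
  disc D} + 1` for fundamental `D`), and
* `QuadraticFields.Scholz1932_reflection` (Scholz 1932: `#Cl₃(D⁺) ≤ #Cl₃(−d) ≤ 3·#Cl₃(D⁺)`),

everything else being PROVED in the tree: the subring recursion and the reduction to cubic fields
(`UniformityEstimateProofs`, `UniformityFieldReduction`), the per-discriminant bound
`#{K : d_K = D₀f²} ≤ 3^{81}·3^{ω(f)}·#Cl₃(D₀)` by class field theory over `ℚ(√D₀)`
(`UniformityPerDiscBound`), Davenport's bound `O(X)` for classes of binary cubic forms of positive
discriminant (`DavenportBoundPos`), and the transfer to negative discriminants (`ThreeTorsionMeanBound`).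

## References

* M. Bhargava, T. Taniguchi, F. Thorne, *Improved error estimates for the Davenport–Heilbronn theorems*,
  Math. Ann. 389 (2024), Prop. 4.5 [BhargavaTaniguchiThorne2023].
* K. Belabas, M. Bhargava, C. Pomerance, *Error estimates for the Davenport–Heilbronn theorems*, Duke
  Math. J. 153 (2010), Lemmas 2.2, 3.3, 3.4 [BelabasBhargavaPomerance2010].
-/

noncomputable section

namespace Literature.NumberTheory.CubicFields

open Literature.NumberTheory.QuadraticFields

/-- **BTT 2023, Prop. 4.5, from Hasse's dictionary and Scholz's reflection theorem** (both named facts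
of the tree, taken as hypotheses; all other inputs proved). [cite: BhargavaTaniguchiThorne2023, Prop. 4.5] -/
theorem btt_uniformity_sqDvd_of_dictionary_of_scholz
    (hdict : threeTorsion_eq_two_mul_cubicFieldCountOfDisc_add_one) (hS : Scholz1932_reflection) :
    btt_uniformity_sqDvd :=
  btt_uniformity_sqDvd_of_mean_of_perDisc (mean_threeTorsion_of_facts hdict hS)
    cubicFieldCountOfDisc_le_threeTorsion

/-- The same with the dictionary hypothesis unfolded. [cite: BhargavaTaniguchiThorne2023, Prop. 4.5] -/
theorem btt_uniformity_sqDvd_of_dictionary_of_scholz'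
    (hdict : ∀ D : ℤ, ((D % 4 = 1 ∧ Squarefree D ∧ D ≠ 1) ∨
      (4 ∣ D ∧ (D / 4 % 4 = 2 ∨ D / 4 % 4 = 3) ∧ Squarefree (D / 4))) →
      quadFieldThreeTorsion D = 2 * cubicFieldCountOfDisc D + 1)
    (hS : Scholz1932_reflection) : btt_uniformity_sqDvd :=
  btt_uniformity_sqDvd_of_mean_of_perDisc (mean_threeTorsion_of_dictionary_of_scholz hdict hS)
    cubicFieldCountOfDisc_le_threeTorsion

end Literature.NumberTheory.CubicFields

end
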